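import Summits.Ventures.KdS.RouteWDoublyResonantAssembly
import Summits.Ventures.KdS.SpinFlipEulerForm
import Summits.Ventures.KdS.SpinFlipMonomial
import HarnessLib

/-!
# Venture KdS — the doubly-resonant candidates, IX: from a resonant radial solution to a T10
# polynomial candidate (glue for `RouteW.NonExtremeStrata`)

HONEST FRAMING (venture `Summits/Ventures/KdS`, cell `pub-kds`; optional kernel object of the
Monday S3 seat, continuing `RouteWDoublyResonantAssembly` (T10 in the kernel)). The assembly file
proves that every doubly-resonant POLYNOMIAL candidate (`m = 0`, `ω = iy`,
`y = u·κ_c = (s − 1 − i₀)·κ₊`, a polynomial solution `Σ_{k≤d} c_k x^k` of the F-homotoped Heun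
equation) violates the angular half-line hypothesis `Im(λ̄ω̄) ≤ 0`. To USE this inside the
formal-Euler-partner argument of `RouteWSpinFlipStrata` one needs the converse bookkeeping, typed
here with no new mathematics:
* `partnerWeight_ne_zero_of_lt` — below the first resonance `ρ + 1 + i₀ = 0` the partner weights
  `W_k`, `k ≤ i₀`, do not vanish;
* `shiftPoly_coeff`, `coeff_eq_zero_of_shiftPoly_coeff_eq_zero` — the shift
  `A(T) = Σ_{i≤D} r_i z_r^i T^i (T+1)^{D−i}` of `SpinFlipEulerForm` is unitriangular
  (`A_k = r_k z_r^k + (terms in r_i, i < k)`), so `A_k = 0 (k ≤ i₀) ⇒ r_k = 0 (k ≤ i₀)`;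
* ★ `im_lambdaBar_mul_conj_pos_of_hatsuda` — if the Hatsuda-gauge function `Y` of a radial datum
  at `(ω, m) = (iy, 0)` on a doubly-resonant stratum solves Hatsuda's Heun equation on `(0, 1)`
  and has the form `x^{1−γ}(z_r − x)^{1−ε}·(X^{i₀+1}ũ)(x)` with `ũ ≠ 0`, `deg ũ ≤ d`, then
  `Im(λ̄ω̄) > 0`: the reverse F-homotopy (`isSolutionOn_homotopy` with exponent `−p`,
  `p = u b_n − s = 1 − ε`) makes `ũ` a polynomial solution of T10's equation
  `Hn(z_r; s+1+u b_n, −d; 2+i₀, s+u+1, 1−s+u b_n; q′)` with `heunV(λ) = q′ + pγ`, and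
  `im_lambdaBar_mul_conj_pos_of_candidate` applies.
Nothing here is a statement about `NonExtremeStrata` itself (that is `RouteWNonExtremeStrata`),
physical quasinormal modes or the Final State Conjecture. 0 cited facts, no `sorry`.
-/

noncomputable section

open Set Complex Finset Polynomial

namespace Summit.Ventures.KdS.RouteW.DoublyResonant

open Literature.Analysis.ODE Literature.Analysis.ODE.GeneralHeun
open Literature.Geometry.Lorentzian Literature.Geometry.Lorentzian.KerrDeSitter
open SpinFlipTS

/-! ### §1. Partner weights below a resonance; the shift polynomial is unitriangular -/

/-- Below the first resonance the partner weight does not vanish: if `ρ + 1 + i ≠ 0` for `i < k`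
and `ρ + η + i ≠ 0` for all `i`, then `W_k ≠ 0`. -/
theorem partnerWeight_ne_zero_of_lt {ρ η : ℂ} {k : ℕ} (h1 : ∀ i : ℕ, i < k → ρ + 1 + i ≠ 0)
    (h2 : ∀ i : ℕ, ρ + η + i ≠ 0) (D : ℕ) : partnerWeight ρ η D k ≠ 0 := by
  unfold partnerWeight
  exact mul_ne_zero (prod_ne_zero_iff.mpr fun i hi => h1 i (mem_range.mp hi))
    (prod_ne_zero_iff.mpr fun i _ => h2 i)

/-- The coefficients of the shift polynomial `A(T) = Σ_{i≤D} r_i z_r^i T^i (T+1)^{D−i}`: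
`A_k = Σ_{i ≤ D} r_i z_r^i · [i ≤ k]·C(D−i, k−i)`. -/
theorem shiftPoly_coeff (zr : ℝ) (D : ℕ) (r : Polynomial ℂ) (k : ℕ) :
    (shiftPoly zr D r).coeff k = ∑ i ∈ range (D + 1),
      r.coeff i * (zr : ℂ) ^ i * (if i ≤ k then (((D - i).choose (k - i) : ℕ) : ℂ) else 0) := by
  unfold shiftPoly
  rw [finsetSum_coeff]
  refine sum_congr rfl fun i _ => ?_
  rw [mul_assoc, coeff_C_mul, coeff_X_pow_mul', coeff_X_add_C_pow, one_pow, one_mul]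

/-- **The shift is unitriangular.** If `z_r ≠ 0`, `K ≤ D + 1` and `A_k = 0` for all `k < K`,
then `r_k = 0` for all `k < K` (`A_k = r_k z_r^k +` terms in `r_i`, `i < k`). -/
theorem coeff_eq_zero_of_shiftPoly_coeff_eq_zero {zr : ℝ} (hzr : zr ≠ 0) {D K : ℕ}
    (hK : K ≤ D + 1) {r : Polynomial ℂ} (h : ∀ k, k < K → (shiftPoly zr D r).coeff k = 0) :
    ∀ k, k < K → r.coeff k = 0 := by
  intro k
  induction k using Nat.strong_induction_on with
  | _ k ih =>
    intro hk
    have hA := h k hk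
    rw [shiftPoly_coeff] at hA
    rw [sum_eq_single k] at hA
    · simp only [le_refl, if_true, Nat.sub_self, Nat.choose_zero_right, Nat.cast_one, mul_one]
        at hA
      rcases mul_eq_zero.mp hA with h0 | h0
      · exact h0
      · exact absurd h0 (pow_ne_zero _ (by exact_mod_cast hzr))
    · intro i _ hik
      rcases Nat.lt_or_gt_of_ne hik with hlt | hgt
      · rw [ih i hlt (hlt.trans hk), zero_mul, zero_mul]
      · rw [if_neg (by omega), mul_zero]
    · intro hkD
      exact absurd (mem_range.mpr (by omega)) hkD

/-- `shiftPoly` of the zero polynomial is zero. -/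
theorem shiftPoly_zero (zr : ℝ) (D : ℕ) : shiftPoly zr D 0 = 0 := by
  unfold shiftPoly
  exact sum_eq_zero fun i _ => by simp

/-! ### §2. From a resonant Hatsuda-gauge function to a T10 candidate -/

/-- ★ **A resonant radial datum whose Hatsuda function is `x^{1−γ}(z_r−x)^{1−ε}·x^{i₀+1}ũ(x)` with
`ũ ≠ 0` violates the angular half-line hypothesis.** On subextremal Kerr–de Sitter with `a ≠ 0`,
at `(ω, m) = (iy, 0)` on a doubly-resonant stratum `y = u·κ_c = (s − 1 − i₀)·κ₊` (`u > 0`,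
`i₀, d ∈ ℕ`, `d = s − 2 − i₀ − u`): if `Y` solves Hatsuda's Heun equation
`Hn(z_r; σ₊, σ₋; γ, δ, ε; heunV(λ))` on `(0, 1)` and
`Y(x) = x^{1−γ}(z_r − x)^{1−ε}·(X^{i₀+1}ũ)(x)` there, with `ũ ≠ 0`, `deg ũ ≤ d`, then
`Im(λ̄·ω̄) > 0`. (Here `γ = 2 + i₀`, so `Y = (z_r − x)^p ũ(x)`, `p = u b_n − s = 1 − ε`; by
`isSolutionOn_homotopy` with exponent `−p`, `ũ = Σ_{k≤d} ũ_k x^k` solves T10's equation with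
`q′ = heunV(λ) − pγ`; then `im_lambdaBar_mul_conj_pos_of_candidate`.) -/
theorem im_lambdaBar_mul_conj_pos_of_hatsuda {M a Λ : ℝ} (hsub : IsSubextremal M a Λ) (ha : a ≠ 0)
    {s u y : ℝ} {i₀ d : ℕ} (hu : 0 < u) (hyc : y = u * surfaceGravity M a Λ (rCosmo M a Λ))
    (hyp : y = (s - 1 - (i₀ : ℝ)) * surfaceGravity M a Λ (rPlus M a Λ))
    (hd : (d : ℝ) = s - 2 - (i₀ : ℝ) - u) {lam : ℂ} {Y : ℝ → ℂ}
    (hY : IsSolutionOn (mobiusZr M a Λ : ℂ) (heunSigmaPlus s) (heunSigmaMinus M a Λ s (I * y) 0)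
      (heunGamma M a Λ s (I * y) 0) (heunDelta M a Λ s (I * y) 0) (heunEps M a Λ s (I * y) 0)
      (heunV M a Λ s (I * y) 0 lam) (Ioo 0 1) Y)
    {ut : Polynomial ℂ} (hut : ut ≠ 0) (hutdeg : ut.natDegree ≤ d)
    (hYform : ∀ x ∈ Ioo (0 : ℝ) 1, Y x = (x : ℂ) ^ (1 - heunGamma M a Λ s (I * y) 0) *
      ((mobiusZr M a Λ - x : ℝ) : ℂ) ^ (1 - heunEps M a Λ s (I * y) 0) *
        (X ^ (i₀ + 1) * ut).eval (x : ℂ)) :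
    0 < (lambdaBar a Λ s (I * y) 0 lam * (starRingEnd ℂ) (I * y)).im := by
  set zr := mobiusZr M a Λ with hzrdef
  have hzr1 : 1 < zr := one_lt_mobiusZr hsub
  -- the Heun data at the doubly-resonant point
  have e1 : heunGamma M a Λ s (I * y) 0 = ((2 + (i₀ : ℝ) : ℝ) : ℂ) :=
    heunGamma_of_resonance hsub hyp
  have hycu : y = ((s + u) - s) * surfaceGravity M a Λ (rCosmo M a Λ) := by rw [hyc]; ring
  have e2 : heunDelta M a Λ s (I * y) 0 = ((s + u + 1 : ℝ) : ℂ) := heunDelta_of_resonance hsub hycu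
  have e3 : heunEps M a Λ s (I * y) 0 = ((s + 1 - u * bNeg M a Λ : ℝ) : ℂ) :=
    heunEps_of_resonance hsub hyc
  have e4 := heunSigmaMinus_of_resonance hsub hyc hyp
  -- the candidate coefficients
  set c : ℕ → ℂ := fun k => ut.coeff k with hcdef
  have hc : ∀ k, d + 1 ≤ k → c k = 0 := fun k hk =>
    coeff_eq_zero_of_natDegree_lt (lt_of_le_of_lt hutdeg (by omega))
  have hc0 : ∃ k, c k ≠ 0 := by
    by_contra hall
    push Not at hall
    exact hut (Polynomial.ext fun k => by simpa [hcdef] using hall k)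
  -- T10's exponent and accessory parameter
  set p : ℂ := ((u * bNeg M a Λ - s : ℝ) : ℂ) with hpdef
  set q : ℂ := heunV M a Λ s (I * y) 0 lam - p * (((2 + (i₀ : ℝ) : ℝ) : ℂ)) with hqdef
  have hV : heunV M a Λ s (I * y) 0 lam =
      q + (((u * bNeg M a Λ - s) * (2 + (i₀ : ℝ)) : ℝ) : ℂ) := by
    rw [hqdef, hpdef]; push_cast; ring
  -- `(z_r − x)^{−p}·Y(x) = Σ_{k≤d} ũ_k x^k` on `(0, 1)`
  have hfun : EqOn (fun x : ℝ => ((zr - x : ℝ) : ℂ) ^ (-p) * Y x) (powSum c (d + 1))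
      (Ioo (0 : ℝ) 1) := by
    intro x hx
    have hx0 : (x : ℂ) ≠ 0 := by exact_mod_cast hx.1.ne'
    have hxz : x < zr := hx.2.trans hzr1
    have hexp1 : (1 : ℂ) - (((2 + (i₀ : ℝ) : ℝ)) : ℂ) = -(((i₀ + 1 : ℕ)) : ℂ) := by
      push_cast; ring
    have hexp2 : (1 : ℂ) - ((s + 1 - u * bNeg M a Λ : ℝ) : ℂ) = p := by
      rw [hpdef]; push_cast; ring
    have hzp : ((zr - x : ℝ) : ℂ) ^ p ≠ 0 := const_sub_cpow_ne_zero p hxz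
    have hxp : (x : ℂ) ^ (i₀ + 1) ≠ 0 := pow_ne_zero _ hx0
    beta_reduce
    rw [hYform x hx, e1, e3, hexp1, hexp2, Complex.cpow_neg, Complex.cpow_neg,
      Complex.cpow_natCast, eval_mul, eval_pow, eval_X,
      eval_eq_sum_range' (lt_of_le_of_lt hutdeg (Nat.lt_succ_self d))]
    simp only [powSum, hcdef]
    field_simp
  -- the reverse F-homotopy: `ũ` solves T10's equation on `(0, 1)`
  have hU : ∀ x ∈ Ioo (0 : ℝ) 1, x < zr := fun x hx => hx.2.trans hzr1
  have hp' : (-p) * ((-p) - 1 + ((1 - s + u * bNeg M a Λ : ℝ) : ℂ)) = 0 := by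
    rw [hpdef]; push_cast; ring
  have hd' : (d : ℂ) = ((s - 2 - (i₀ : ℝ) - u : ℝ) : ℂ) := by rw [← hd]; push_cast; rfl
  have hαβ' : heunSigmaPlus s * heunSigmaMinus M a Λ s (I * y) 0 =
      ((s + 1 + u * bNeg M a Λ : ℝ) : ℂ) * (-(d : ℂ)) +
        (-p) * ((((2 + (i₀ : ℝ) : ℝ)) : ℂ) + ((s + u + 1 : ℝ) : ℂ)) := by
    rw [e4, hd', hpdef]
    unfold heunSigmaPlus
    push_cast
    ring
  have eε : heunEps M a Λ s (I * y) 0 = ((1 - s + u * bNeg M a Λ : ℝ) : ℂ) + 2 * (-p) := by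
    rw [e3, hpdef]; push_cast; ring
  have eq' : heunV M a Λ s (I * y) 0 lam = q - (-p) * (((2 + (i₀ : ℝ) : ℝ) : ℂ)) := by
    rw [hqdef]; ring
  have hY' := hY
  rw [e1, e2, eε, eq'] at hY'
  have hT := isSolutionOn_homotopy (U := Ioo (0 : ℝ) 1) hU hp' hαβ' hY'
  have hsolT : IsSolutionOn (zr : ℂ) ((s + 1 + u * bNeg M a Λ : ℝ) : ℂ) (-(d : ℂ))
      ((2 + (i₀ : ℝ) : ℝ) : ℂ) ((s + u + 1 : ℝ) : ℂ) ((1 - s + u * bNeg M a Λ : ℝ) : ℂ) q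
      (Ioo (0 : ℝ) 1) (powSum c (d + 1)) :=
    SpinFlipTS.IsSolutionOn.congr_eqOn isOpen_Ioo hT hfun
  exact im_lambdaBar_mul_conj_pos_of_candidate hsub ha hu (Nat.cast_nonneg i₀) hyc hyp hd hc hc0
    one_pos hsolT hV

end Summit.Ventures.KdS.RouteW.DoublyResonant
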